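import Literature.MathematicalPhysics.QuantumFieldTheory.Balaban1983to89.B2Ineq2109HiggsLatticeTower

/-!
# `Balaban1983to89.B2Eq2108ErrorAsPrinted` — [Balaban1982Higgs2] **(2.108)** p. 580, the error term `O((Lᵏε)^κ)|Λ₃^{(k)}|`
# ON THE (Higgs)₂,₃ CARRIER OF RECORD under the field restriction (2.55)₄ AS PRINTED — `|φ(x)| ≤ (c₁/λ(L^{k−1}ε)^{1/4})p(L^{k−1}ε)`
# with `λ(·)` the FUNCTION `λ(ε) = λε^{4−d}` of p. 557 — for EVERY dimension `d` (exponent `(4−d)/4`: `1/4` at `d = 3`, `1/2`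
# at `d = 2`); companions' `_printed` theorems are its `d = 3` normal form

statement-level skeleton of published theorems with citation tags; proofs where landed; nothing here is a claim about the Yang–Mills mass gap

PDF held: `paper:balaban1982-cmp86-higgs23-ii` (T. Bałaban, *(Higgs)₂,₃ quantum fields in a finite volume. II. An upper
bound*, Commun. Math. Phys. **86** (1982) 555–594 [Balaban1982Higgs2]; journal page = PDF page + 554).  Pages RE-READ AS
IMAGES for this file on the ×2 renders `run/shared/lean/pub/pub-balaban/b2b-balaban-ref1/pages/1982-cmp86-higgs23-II/
1982-cmp86-higgs23-II-p003-x2.png` (p. 557) and `…-p016-x2.png` (p. 570); p. 580 [PDF 26] as in the companions.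

CITATION HEADER (lean-in-tree rule).  Cell `lit-balaban` (HOME `run/shared/lean/pub/lit-balaban/`), Phase-2 proof seat **p23**
gen 18 (unit `lit-balaban-p23-g18`); SKELETON row **B2.Eq2.109** ((2.108)–(2.109) p. 580; fold owner r02, second reader r14,
referee ref-4) — cells only, no head change.  A NEW LEAF over own `B2Eq2108ErrorHiggsLattice` (p325417/p331294:
`abs_form_hk_le_pow`, `abs_form_hk_le_printed`), own `B2Ineq2109HiggsLatticeTower` (p326609/p331071: `TowerData`,
`printedRad`, `abs_form_hk_le_printed_tower`), own `B2Eq2108ErrorBound` v1.3 (p336254: `thrPhi_pFn_nonneg`,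
`printedThreshold_thrPhi_le`) and the typer's `B2LargeField` (r02, p239284: `thrPhi`, `lambdaEps`) — all used BY NAME; no
module is touched, nothing of [B2] is asserted as a fact.  Serves second-reader note **S-B2-r14g16-1** (r14 gen 16,
`lit-balaban-r14/SECONDREAD-B2.md` v41): the companions' `_printed` corollaries carry the threshold `cl·(L^{k−1}ε)^{−1/4}·
p(L^{k−1}ε)`, i.e. (2.55)₄ with `λ(·)` read as a constant — exactly the `d = 3` case; here the same conclusions are proved
under the restriction as printed, for every `d`.

WHAT IS PRINTED (renders re-read).  p. 557 [PDF 3], (2.2): «|φ(x)| > (1/(λε^{4−d})^{1/4}) p(ε)»; (2.5): «|φ(x)| ≤ (1/λ(ε)^{1/4})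
p(ε)»; last line: «where λ(ε) = λε^{4−d}.»; «p(ε) = b₀(1 + log ε⁻¹)^p, p > 2».  p. 570 [PDF 16], (2.55): «|φ(x)| ≤
(c₁/λ(L^{k−1}ε)^{1/4}) p(L^{k−1}ε) for x ∈ Λ₋₁^{(k−1)′}».  p. 580 [PDF 26], (2.108) last line «+ O((Lᵏε)^κ)|Λ₃^{(k)}|.» and
(2.109) «… for x, x′ ∈ Λ₆^{(k−1)′} and arbitrary κ» (quoted in full in `B2Eq2108ErrorBound`).  Hence the threshold is
`c₁λ^{−1/4}(L^{k−1}ε)^{−(4−d)/4}p(L^{k−1}ε)` = the typer's `c₁·thrPhi λ (L^{k−1}ε) d (p(L^{k−1}ε))` (`B2LargeField.thrPhi lam ε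
d pε = pε/(λε^{4−d})^{1/4}`), polynomial × logarithmic in `(Lᵏε)⁻¹`, so «`e^{−δ₁r(Lᵏε)}` beats every power» (r14's
`B2StepK.rDecayBeatsPowers_of_printed`) absorbs it for every `d` — the companions' `_pow` theorems with `m = (4−d)/4 + p`.

WHAT IS KERNEL-CHECKED (zero `sorry`, theorems only, no `def`, no new `… : Prop`; axioms standard).
 §1 **`abs_form_hk_le_printed'`** — the unit-lattice family of `B2Eq2108ErrorHiggsLattice` (`B2Ineq2109HiggsLattice.Inst`/`Adm`,
    fixed `d, L > 1, a > 0, N`): for every `κ` ONE `C′` with `(Lᵏε)²|⟨Λ₆′φ, H_kΛ₆′φ⟩| ≤ C′(Lᵏε)^κ|Λ₃^{(k)}|` for every admissible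
    step with `r = r(Lᵏε)` in the printed ranges, `Lᵏε ≤ 1`, and `|φ| ≤ c₁·p(L^{k−1}ε)/λ(L^{k−1}ε)^{1/4}` on `Λ₆^{(k−1)′}`,
    `λ(ε) = λε^{4−d}` with the carrier's dimension `d`, any `λ > 0`, `c₁ ≥ 0`.
 §2 **`abs_form_hk_le_printed_tower'`** — the same for the (2.7)–(2.8)/(2.43) tower steps of `B2Ineq2109HiggsLatticeTower`
    (`TowerData`, printed radii `printedRad`).

HONEST SCOPE.  (a) Exactly the scope of the companions' `_printed` theorems (concrete `H_k = deltaKA`-recipe at a regular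
background field on the (Higgs)₂,₃ torus; (2.8) separations as hypotheses of `Adm`; `B2.Params` `Q` a free printed-range
record, its `Q.L` the `L` of `L^{k−1}ε = (Lᵏε)/L` as in the companions), with ONLY the `φ`-threshold changed to the printed
one; `d` in `λ(ε) = λε^{4−d}` is the carrier's dimension (`P.d = d`).  (b) No optimisation of constants.  (c) Value = the
printed error term of (2.108) under the printed restriction (2.55)₄ at `d = 2` as well as `d = 3`; NOT summit progress.
-/

noncomputable section

open scoped BigOperators Matrix

namespace Literature.MathematicalPhysics.QuantumFieldTheory.Balaban1983to89.B2Eq2108ErrorAsPrinted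

open HiggsLattice B1Eq230FluctCov
open B2Ineq2109HiggsLattice B2Eq2108ErrorHiggsLattice B2Ineq2109HiggsLatticeTower
open Matrix

/-! ## §1 The unit-lattice family of `B2Eq2108ErrorHiggsLattice` -/

/-- **THE ERROR TERM OF (2.108) UNDER THE PRINTED RESTRICTION (2.55)₄, FOR EVERY `d`** (unit-lattice form, (Higgs)₂,₃
carrier): with `r = r(Lᵏε)` and `p(·)` of the printed ranges (`B2.Params.Printed`: `p > 2`, `r > 1`, `L > 1`, `b₀ > 0`,
`R > 0`), `ℓ = Lᵏε ∈ (0,1]`, any `λ > 0`, `c₁ ≥ 0`, and `|φ(x)| ≤ (c₁/λ(L^{k−1}ε)^{1/4})p(L^{k−1}ε)` on `Λ₆^{(k−1)′}` with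
`λ(ε) = λε^{4−d}` the FUNCTION of p. 557 (typer's `B2LargeField.thrPhi λ (ℓ/L) d (p(ℓ/L))`, `L^{k−1}ε = ℓ/L`; `d` = the carrier's
dimension): for every `κ` there is `C′` with `(Lᵏε)²|⟨Λ₆′φ, H_kΛ₆′φ⟩| ≤ C′(Lᵏε)^κ|Λ₃^{(k)}|` for every admissible step — the
printed *"+ O((Lᵏε)^κ)|Λ₃^{(k)}|"* of (2.108).  (`B2Eq2108ErrorHiggsLattice.abs_form_hk_le_printed` is the `d = 3` normal form
`cl·(ℓ/L)^{−1/4}p(ℓ/L)`, `cl = c₁λ^{−1/4}`; at `d = 2` the printed exponent is `1/2` — second-reader note S-B2-r14g16-1.)  By the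
companion's `abs_form_hk_le_pow` with `T = c₁λ^{−1/4}b₀L^{(4−d)/4+p}`, `m = (4−d)/4 + p` (`B2Eq2108ErrorBound.printedThreshold_thrPhi_le`).
[cite: Balaban1982Higgs2, (2.108) p.580, (2.55) p.570, (2.2)/(2.5) p.557] -/
theorem abs_form_hk_le_printed' (d L : ℕ) (hL : 1 < L) {a : ℝ} (ha : 0 < a) (N : ℕ) (Q : B2.Params) (hQ : Q.Printed)
    {lam c₁ : ℝ} (hlam : 0 < lam) (hc₁ : 0 ≤ c₁) (κ : ℝ) :
    ∃ C' : ℝ, ∀ (P : HiggsLattice.Params), P.d = d → P.L = L → ∀ (i : Inst P N), Adm a i →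
      0 < P.mesh (i.j + 1) → P.mesh (i.j + 1) ≤ 1 → i.r = B2.rFn Q.R Q.r (P.mesh (i.j + 1)) →
        ∀ (φ : ↥i.L6 × Ix N → ℝ),
          (∀ p, |φ p| ≤ c₁ * B2LargeField.thrPhi lam (P.mesh (i.j + 1) / Q.L) d
              (B2.pFn Q.b₀ Q.p (P.mesh (i.j + 1) / Q.L))) →
          P.mesh (i.j + 1) ^ 2 * |φ ⬝ᵥ (i.Hk a *ᵥ φ)| ≤ C' * P.mesh (i.j + 1) ^ κ * (i.L3.card : ℝ) := by
  obtain ⟨hp2, -, hL1, -, -, -, hb0, -⟩ := id hQ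
  have hT : 0 ≤ c₁ * lam ^ (-(1 / 4 : ℝ)) * Q.b₀ * (Q.L : ℝ) ^ (((4 : ℝ) - d) / 4 + Q.p) :=
    mul_nonneg (mul_nonneg (mul_nonneg hc₁ (Real.rpow_nonneg hlam.le _)) hb0.le)
      (Real.rpow_nonneg (Nat.cast_nonneg _) _)
  obtain ⟨C', h⟩ := abs_form_hk_le_pow d L hL ha N Q hQ hT (((4 : ℝ) - d) / 4 + Q.p) κ
  refine ⟨C', fun P hd hL' i hA hs hs1 hr φ hφ => ?_⟩
  have hQL : (1 : ℝ) ≤ Q.L := by exact_mod_cast hL1.le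
  have hx1 : P.mesh (i.j + 1) / Q.L ≤ 1 := by rw [div_le_one (by linarith)]; linarith
  exact h P hd hL' i hA hs hs1 hr _ φ
    (B2Eq2108ErrorBound.thrPhi_pFn_nonneg hlam hc₁ hb0.le (div_pos hs (by linarith)) hx1 d)
    (B2Eq2108ErrorBound.printedThreshold_thrPhi_le hlam hc₁ hb0.le (by linarith) hQL hs hs1 d) hφ

/-! ## §2 The (2.7)–(2.8)/(2.43) tower steps of `B2Ineq2109HiggsLatticeTower` -/

/-- **THE PRINTED `O((Lᵏε)^κ)|Λ₃^{(k)}|` FOR THE TOWER UNDER (2.55)₄ AS PRINTED, FOR EVERY `d`**: with the printed radii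
`rad = r(L^·ε)` (`printedRad`) and `|φ| ≤ c₁·p(Lᵏε/L)/λ(Lᵏε/L)^{1/4}` on `Λ₆^{(k−1)′}`, `λ(ε) = λε^{4−d}` (`d` = the carrier's
dimension), `λ > 0`, `c₁ ≥ 0`: for every `κ` ONE `C′` (per `d, L, a, N`, ranges, `λ`, `c₁`) with `(Lᵏε)²|⟨φ, H_kφ⟩| ≤
C′(Lᵏε)^κ|Λ₃^{(k)}|` (unit-lattice currency).  (`B2Ineq2109HiggsLatticeTower.abs_form_hk_le_printed_tower` is the `d = 3`
normal form.) [cite: Balaban1982Higgs2, (2.108) p.580, (2.55) p.570, (2.7) p.558, (2.2)/(2.5) p.557] -/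
theorem abs_form_hk_le_printed_tower' (d L : ℕ) (hL : 1 < L) {a : ℝ} (ha : 0 < a) (N : ℕ) (Q : B2.Params)
    (hQ : Q.Printed) {lam c₁ : ℝ} (hlam : 0 < lam) (hc₁ : 0 ≤ c₁) (κ : ℝ) :
    ∃ C' : ℝ, ∀ (P : HiggsLattice.Params), P.d = d → P.L = L → ∀ (t : TowerData P N), TowerData.Reg a t →
      P.mesh (t.j + 1) ≤ 1 → t.rad = printedRad Q P →
        ∀ (φ : ↥t.toInst.L6 × Ix N → ℝ),
          (∀ p, |φ p| ≤ c₁ * B2LargeField.thrPhi lam (P.mesh (t.j + 1) / Q.L) d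
              (B2.pFn Q.b₀ Q.p (P.mesh (t.j + 1) / Q.L))) →
          P.mesh (t.j + 1) ^ 2 * |φ ⬝ᵥ (t.toInst.Hk a *ᵥ φ)| ≤ C' * P.mesh (t.j + 1) ^ κ * ((t.lam 3).card : ℝ) := by
  obtain ⟨C', h⟩ := abs_form_hk_le_printed' d L hL ha N Q hQ hlam hc₁ κ
  refine ⟨C', fun P hd hL' t ht hs1 hrad φ hφ => ?_⟩
  exact h P hd hL' t.toInst (t.adm_toInst ht) (P.mesh_pos _) hs1 (by simp [printedRad, hrad]) φ hφ

end Literature.MathematicalPhysics.QuantumFieldTheory.Balaban1983to89.B2Eq2108ErrorAsPrinted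

end
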